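import Summits.Ventures.YMGap.RobustBall.StateDerivativeOnBallS
import Summits.Ventures.YMGap.RobustBall.SecondSusceptibilityS
import HarnessLib

/-!
# Venture YMGap, track ROBUST-BALL (Y2) — TIER 2: THE UNIFORM SECOND-ORDER TAYLOR BOUND — THE STATE MAP IS `C^{1,1}` ALONG EVERY DIRECTION OF
# FINITE SIZE-WEIGHTED LOAD, REMAINDER `O(s²)` WITH ONE CONSTANT FOR THE BALL

HONEST FRAMING. WHAT THIS IS: a venture file (cell `pub-ymgap`, track Y2 ROBUST-BALL, seat rb-p1, theorems only), the upgrade of the first-order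
Taylor bound `StateTaylorRemainderS` (remainder `O(|s|^{3/2})`) to `O(s²)` for directions of finite SIZE-WEIGHTED Lipschitz load
(`Σ'_{X∋e} #X·Σ_y lipV_X(y) ≤ L₂` — finite-range and bounded-size directions), using the uniform bound on the partial sums of the second-order
susceptibility (`SecondSusceptibilityS.sum_abs_threePoint_le_S`):
* `hasDerivAt_cov_of_mem_perturbedGibbsMeasuresS_add_smul` — FEYNMAN–HELLMANN FOR COVARIANCES along a local (finitely many terms) line:
  `d/ds cov_{ν(s)}(F, G) = −Σ_{A∈T} u₃^{ν(s)}(F; G; V_A)` (the third cumulant);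
* ★★ `abs_taylor_remainder_two_le_S` — member `W ∈ Ball(a, Λ, t)`, direction `V ∈ Ball(a_V, Λ_V, t)` with Lipschitz witnesses of total load `≤ L` and
  size-weighted load `≤ L₂`, `a + s₀a_V ≤ a'`, `Λ + s₀Λ_V ≤ Λ'`, pair door `ρ' < 1` at `(a', Λ', t)`, `t > 0`; `ν(s) ∈ 𝒢(W + sV)` on `|s| ≤ s₀`; `F` bounded
  measurable local Frobenius-Lipschitz.  Then for every `|s| < s₀`:
  `|∫F dν(s) − ∫F dν(0) + s·Σ'_X cov_{ν(0)}(F, V_X)| ≤ K₂ · s²`, `K₂ = 768 N√N (Σδ_F)(#Λ_F C)(L² #Λ_F C + 2 L L₂ C)`, `C = d((1+e^{−(t/3)/d})/(1−e^{−(t/3)/d}))^d`: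
  the susceptibility series (the derivative of the state along the line) is LIPSCHITZ in `s` with the member-independent constant `K₂`
  (`abs_tsum_cov_sub_tsum_cov_le_lipschitz_S`) — along the truncated lines its derivative is a finite double sum of third cumulants bounded by
  `K₂`, and the truncated susceptibility sums converge to the series (screened stability + one summable majorant);
(The `SU(2)` `ℤ⁴` cell is left to the cells file of the chain.)
WHAT THIS IS NOT: a `C²` statement (the identification of `lim (χ(s) − χ(0))/s` with the double cumulant series is the successor file); analyticity;
one-sided Dobrushin-comparison constants at lattice strong coupling; nothing about the continuum limit or a Clay-sense mass gap.
-/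

noncomputable section

open MeasureTheory Function Finset ProbabilityTheory Real Filter Topology
open scoped NNReal
open Literature.Probability.LatticeModels
open Literature.Probability.LatticeModels.DobrushinMetric
open Literature.MathematicalPhysics.QuantumLattice
open Literature.MathematicalPhysics.QuantumFieldTheory hiding ZdEdge
open Summit.QuantumFields.BalabanUV.InfraRed.StrongCouplingPoincareDoorSUN (oneLinkPoincareSUN_two_sharp)

namespace Summit.Ventures.YMGap.RobustBall

variable {d N : ℕ}

/-! ### Feynman–Hellmann for covariances along a local line -/

section FH

variable {G : Type*} [Group G] [TopologicalSpace G] [IsTopologicalGroup G] [CompactSpace G] [MeasurableSpace G] [BorelSpace G]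
  [SecondCountableTopology G] [T2Space G] (ρ : G →* Matrix (Fin N) (Fin N) ℂ)

/-- **Feynman–Hellmann for covariances along a local line.**  `W` link-summable continuous (unique DLR state `μ`), `V` continuous own-link terms
listed by `suppV ⊆ T` (finitely many), `ν(s) ∈ 𝒢(W + sV)`; `F`, `G` bounded measurable.  Then at every `b`:
`d/ds cov_{ν(s)}(F, G) = −Σ_{A∈T} (cov(FG, V_A) − ⟨F⟩cov(G, V_A) − ⟨G⟩cov(F, V_A))` (all moments at `ν(b)`). -/
theorem hasDerivAt_cov_of_mem_perturbedGibbsMeasuresS_add_smul (hρ : Continuous ρ) (β : ℝ)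
    {W : Potential (ZdEdge d) G} {B : Finset (ZdEdge d) → ℝ} (hW : IsLinkSummable W B) (hWc : ∀ X, Continuous (W X))
    (hWdep : ∀ X, DependsOn (W X) (↑X : Set (ZdEdge d)))
    {V : Potential (ZdEdge d) G} (hVc : ∀ X, Continuous (V X)) (hVdep : ∀ X, DependsOn (V X) (↑X : Set (ZdEdge d)))
    {suppV : Finset (ZdEdge d) → Finset (Finset (ZdEdge d))} (hsuppV : V.IsSupportedBy suppV)
    {T : Finset (Finset (ZdEdge d))} (hT : ∀ Λ, suppV Λ ⊆ T)
    (huniq : (perturbedGibbsMeasuresS ρ β W).Subsingleton)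
    {μ : Measure (LGConfig d G)} (hμ : μ ∈ perturbedGibbsMeasuresS ρ β W)
    {ν : ℝ → Measure (LGConfig d G)} (hν : ∀ s, ν s ∈ perturbedGibbsMeasuresS ρ β (W + s • V))
    {F : LGConfig d G → ℝ} (hFm : Measurable F) {CF : ℝ} (hFb : ∀ U, |F U| ≤ CF)
    {G' : LGConfig d G → ℝ} (hGm : Measurable G') {CG : ℝ} (hGb : ∀ U, |G' U| ≤ CG) (b : ℝ) :
    HasDerivAt (fun s => cov[F, G'; ν s])
      (-(∑ A ∈ T, (cov[fun U => F U * G' U, V A; ν b] - (∫ U, F U ∂(ν b)) * cov[G', V A; ν b] -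
        (∫ U, G' U ∂(ν b)) * cov[F, V A; ν b]))) b := by
  have hprob : ∀ s, IsProbabilityMeasure (ν s) := fun s => (show IsGibbsMeasure _ _ from hν s).isProbabilityMeasure
  have hCF0 : 0 ≤ CF := (abs_nonneg _).trans (hFb 1)
  have hFG : ∀ U, |F U * G' U| ≤ CF * CG := fun U => by rw [abs_mul]; exact mul_le_mul (hFb U) (hGb U) (abs_nonneg _) hCF0
  -- the three moments along the line
  have hFGm : Measurable (fun U => F U * G' U) := hFm.mul hGm
  have h1 := (hasDerivAt_integral_of_mem_perturbedGibbsMeasuresS_add_smul ρ hρ β hW hWc hWdep hVc hVdep hsuppV hT huniq hμ hν hFGm hFG b).2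
  have h2 := (hasDerivAt_integral_of_mem_perturbedGibbsMeasuresS_add_smul ρ hρ β hW hWc hWdep hVc hVdep hsuppV hT huniq hμ hν hFm hFb b).2
  have h3 := (hasDerivAt_integral_of_mem_perturbedGibbsMeasuresS_add_smul ρ hρ β hW hWc hWdep hVc hVdep hsuppV hT huniq hμ hν hGm hGb b).2
  -- `cov = ∫FG − ∫F ∫G` along the line
  have hcov : (fun s => cov[F, G'; ν s]) = fun s => (∫ U, F U * G' U ∂(ν s)) - (∫ U, F U ∂(ν s)) * ∫ U, G' U ∂(ν s) := by
    funext s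
    haveI := hprob s
    have hF2 : MemLp F 2 (ν s) := MemLp.of_bound hFm.aestronglyMeasurable CF (Eventually.of_forall fun U => by rw [Real.norm_eq_abs]; exact hFb U)
    have hG2 : MemLp G' 2 (ν s) := MemLp.of_bound hGm.aestronglyMeasurable CG (Eventually.of_forall fun U => by rw [Real.norm_eq_abs]; exact hGb U)
    rw [covariance_eq_sub hF2 hG2]; rfl
  rw [hcov]
  have h := h1.sub (h2.mul h3)
  refine h.congr_deriv ?_
  -- linearity of the covariance in the source `H = Σ_{A∈T} V_A`
  haveI := hprob b
  choose CV hCV using fun X => exists_bound_of_continuous (hVc X)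
  have hV2 : ∀ A ∈ T, MemLp (fun U => V A U) 2 (ν b) := fun A _ =>
    MemLp.of_bound (hVc A).measurable.aestronglyMeasurable (CV A) (Eventually.of_forall fun U => by rw [Real.norm_eq_abs]; exact hCV A U)
  have hF2 : MemLp F 2 (ν b) := MemLp.of_bound hFm.aestronglyMeasurable CF (Eventually.of_forall fun U => by rw [Real.norm_eq_abs]; exact hFb U)
  have hG2 : MemLp G' 2 (ν b) := MemLp.of_bound hGm.aestronglyMeasurable CG (Eventually.of_forall fun U => by rw [Real.norm_eq_abs]; exact hGb U)
  have hFG2 : MemLp (fun U => F U * G' U) 2 (ν b) :=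
    MemLp.of_bound hFGm.aestronglyMeasurable (CF * CG) (Eventually.of_forall fun U => by rw [Real.norm_eq_abs]; exact hFG U)
  rw [covariance_fun_sum_right' hV2 hFG2, covariance_fun_sum_right' hV2 hF2, covariance_fun_sum_right' hV2 hG2]
  simp only [Finset.sum_sub_distrib, ← Finset.mul_sum]
  ring

end FH

/-! ### The uniform second-order Taylor bound -/

section SUN

variable {W V : Potential (ZdEdge d) (Matrix.specialUnitaryGroup (Fin N) ℂ)}

/-- ★★ **THE SUSCEPTIBILITY SERIES IS LIPSCHITZ ALONG THE LINE, with a member-independent constant, for directions of finite size-weighted load.**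
Member `W ∈ Ball(a, Λ, t)`, direction `V ∈ Ball(a_V, Λ_V, t)` with Lipschitz witnesses of total load `≤ L` and size-weighted load `≤ L₂`,
`a + s₀a_V ≤ a'`, `Λ + s₀Λ_V ≤ Λ'`, pair door `ρ' < 1` at `(a', Λ', t)`, `t > 0`; `ν(s) ∈ 𝒢(W + sV)` on `|s| ≤ s₀`; `F` bounded measurable local
Frobenius-Lipschitz.  Then for every `|σ| ≤ s₀`:
`|Σ'_X cov_{ν(σ)}(F, V_X) − Σ'_X cov_{ν(0)}(F, V_X)| ≤ K₂ |σ|`, `K₂ = 768 N√N (Σδ_F)(#Λ_F C)(L·L·#Λ_F C + L L₂ C + L L₂ C)`,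
`C = d((1+e^{−(t/3)/d})/(1−e^{−(t/3)/d}))^d`. -/
theorem abs_tsum_cov_sub_tsum_cov_le_lipschitz_S (hd : 1 ≤ d) (hN : 1 ≤ N) {β b c v a' Λ' t : ℝ}
    (hc : 0 ≤ c) (hv : 0 ≤ v) (hb : |β| * (2 * ((d : ℝ) - 1)) ≤ b)
    (hP : ∀ B : Matrix (Fin N) (Fin N) ℂ, matrixOpNorm B ≤ b →
      ∀ (ψ : Matrix.specialUnitaryGroup (Fin N) ℂ → ℝ) (M : ℝ), 0 ≤ M →
        (∀ x y, |ψ x - ψ y| ≤ M * suFrobDist x y) →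
        Var[ψ; (haarProbability (Matrix.specialUnitaryGroup (Fin N) ℂ)).tilted
          fun g => (N : ℝ) * ((g : Matrix (Fin N) (Fin N) ℂ) * B).trace.re] ≤ c * M ^ 2)
    (hVB : ∀ B : Matrix (Fin N) (Fin N) ℂ, matrixOpNorm B ≤ b → ∀ Δ : Matrix (Fin N) (Fin N) ℂ,
      Var[fun g : Matrix.specialUnitaryGroup (Fin N) ℂ =>
          (N : ℝ) * ((g : Matrix (Fin N) (Fin N) ℂ) * Δ).trace.re;
        (haarProbability (Matrix.specialUnitaryGroup (Fin N) ℂ)).tilted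
          fun g => (N : ℝ) * ((g : Matrix (Fin N) (Fin N) ℂ) * B).trace.re] ≤ v * frobNorm Δ ^ 2)
    (ht : 0 < t) (hρ : 6 * ((d : ℝ) - 1) * |β| * (exp a' * exp t * Real.sqrt (c * v)) + exp (a' / 2) * Real.sqrt c * Λ' < 1)
    {a Λ aV ΛV s₀ : ℝ} (hW : MemBallZdS a Λ t W) (hV : MemBallZdS aV ΛV t V) (haV : 0 ≤ aV) (hΛV : 0 ≤ ΛV)
    (hs₀ : 0 < s₀) (ha' : a + s₀ * aV ≤ a') (hΛ' : Λ + s₀ * ΛV ≤ Λ')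
    {lipV : Finset (ZdEdge d) → ZdEdge d → ℝ} (hlipV : ∀ X, IsLipBound suFrobDist (V X) (lipV X)) {L L₂ : ℝ}
    (hLs : ∀ e, Summable fun X : Finset (ZdEdge d) => (if e ∈ X then ∑ y ∈ X, lipV X y else 0))
    (hL : ∀ e, ∑' X : Finset (ZdEdge d), (if e ∈ X then ∑ y ∈ X, lipV X y else 0) ≤ L)
    (hL2s : ∀ e, Summable fun X : Finset (ZdEdge d) => (if e ∈ X then X.card * ∑ y ∈ X, lipV X y else 0))
    (hL2 : ∀ e, ∑' X : Finset (ZdEdge d), (if e ∈ X then X.card * ∑ y ∈ X, lipV X y else 0) ≤ L₂)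
    {ν : ℝ → Measure (LGConfig d (Matrix.specialUnitaryGroup (Fin N) ℂ))}
    (hν : ∀ s ∈ Set.Icc (-s₀) s₀, ν s ∈ perturbedGibbsMeasuresS (d := d) (fundamentalRep (Fin N)) (N * β) (W + s • V))
    {F : LGConfig d (Matrix.specialUnitaryGroup (Fin N) ℂ) → ℝ} (hFm : Measurable F) {ΛF : Finset (ZdEdge d)}
    (hFdep : DependsOn F (↑ΛF : Set (ZdEdge d))) {MF : ℝ} (hMF : ∀ σ, |F σ| ≤ MF) {δF : ZdEdge d → ℝ}
    (hδF : IsLipBound suFrobDist F δF) :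
    ∀ σ ∈ Set.Icc (-s₀) s₀,
      |(∑' X : Finset (ZdEdge d), cov[F, V X; ν σ]) - ∑' X : Finset (ZdEdge d), cov[F, V X; ν 0]| ≤
        768 * N * Real.sqrt N * (∑ y ∈ ΛF, δF y) *
          (ΛF.card * (d * ((1 + exp (-(t / 3 / d))) / (1 - exp (-(t / 3 / d)))) ^ d)) *
          (L * L * (ΛF.card * (d * ((1 + exp (-(t / 3 / d))) / (1 - exp (-(t / 3 / d)))) ^ d)) +
            L * L₂ * (d * ((1 + exp (-(t / 3 / d))) / (1 - exp (-(t / 3 / d)))) ^ d) +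
            L * L₂ * (d * ((1 + exp (-(t / 3 / d))) / (1 - exp (-(t / 3 / d)))) ^ d)) * |σ| := by
  classical
  haveI : SecondCountableTopology (Matrix (Fin N) (Fin N) ℂ) :=
    inferInstanceAs (SecondCountableTopology (Fin N → Fin N → ℂ))
  haveI : SecondCountableTopology (Matrix.specialUnitaryGroup (Fin N) ℂ) :=
    Topology.IsEmbedding.subtypeVal.secondCountableTopology
  set J : Set ℝ := Set.Icc (-s₀) s₀ with hJ
  have habs : ∀ {s}, s ∈ J → |s| ≤ s₀ := fun hs => abs_le.2 ⟨by linarith [hs.1], hs.2⟩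
  obtain ⟨K₂, hK₂⟩ : ∃ K : ℝ, K = 768 * N * Real.sqrt N * (∑ y ∈ ΛF, δF y) *
      (ΛF.card * (d * ((1 + exp (-(t / 3 / d))) / (1 - exp (-(t / 3 / d)))) ^ d)) *
      (L * L * (ΛF.card * (d * ((1 + exp (-(t / 3 / d))) / (1 - exp (-(t / 3 / d)))) ^ d)) +
        L * L₂ * (d * ((1 + exp (-(t / 3 / d))) / (1 - exp (-(t / 3 / d)))) ^ d) +
        L * L₂ * (d * ((1 + exp (-(t / 3 / d))) / (1 - exp (-(t / 3 / d)))) ^ d)) := ⟨_, rfl⟩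
  rw [← hK₂]
  obtain ⟨T, hT⟩ := exists_term_exhaustion d
  -- the member `W` at the bigger loads: uniqueness and a state `μ`
  have hW' : MemBallZdS a' Λ' t W := hW.mono (by nlinarith) (by nlinarith)
  obtain ⟨BW, hBW⟩ := hW'.summable
  obtain ⟨osc, lip, ℓ, hosc, hlip, hoscs, hosca, hlips, hℓ, hℓs, hℓt⟩ := hW'.loads
  have huniq := subsingleton_perturbedGibbsMeasuresS_SU hd hN hc hv hb hP hVB hBW hW'.continuous hW'.dependsOn hosc hoscs hosca
    hlip hlips hℓ ht.le hℓs hℓt hρ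
  obtain ⟨μ, hμ⟩ := perturbedGibbsMeasuresS_nonempty _ (continuous_fundamentalRep (Fin N)) _ hBW hW'.continuous hW'.dependsOn
  have hVb : ∀ X, ∃ C, ∀ U, |V X U| ≤ C := fun X => exists_bound_of_continuous (hV.continuous X)
  set Vn : ℕ → Potential (ZdEdge d) (Matrix.specialUnitaryGroup (Fin N) ℂ) := fun n => (↑(T n) : Set (Finset (ZdEdge d))).indicator V
    with hVn
  have hVnc : ∀ n X, Continuous (Vn n X) := fun n X => continuous_indicator_apply hV.continuous X
  have hVndep : ∀ n X, DependsOn (Vn n X) (↑X : Set (ZdEdge d)) := fun n X => dependsOn_indicator_apply hV.dependsOn X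
  have hVnsupp : ∀ n, (Vn n).IsSupportedBy fun _ => T n := fun n => isSupportedBy_indicator (T n) V
  set νn : ℕ → ℝ → Measure (LGConfig d (Matrix.specialUnitaryGroup (Fin N) ℂ)) :=
    fun n s => μ.tilted fun U => -s * ∑ A ∈ T n, Vn n A U with hνn_def
  have hνn : ∀ n s, νn n s ∈ perturbedGibbsMeasuresS (d := d) (fundamentalRep (Fin N)) (N * β) (W + s • Vn n) := fun n s => by
    rw [perturbedGibbsMeasuresS_add_smul_eq_singleton (fundamentalRep (Fin N)) (continuous_fundamentalRep (Fin N)) (N * β) hBW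
      hW'.continuous hW'.dependsOn (hVnc n) (hVndep n) (hVnsupp n) (fun _ => subset_rfl) huniq hμ s]
    exact Set.mem_singleton _
  have hprob_n : ∀ n s, IsProbabilityMeasure (νn n s) := fun n s => (show IsGibbsMeasure _ _ from hνn n s).isProbabilityMeasure
  have hprob : ∀ s ∈ J, IsProbabilityMeasure (ν s) := fun s hs => (show IsGibbsMeasure _ _ from hν s hs).isProbabilityMeasure
  -- (a) Feynman–Hellmann for the truncated susceptibility sums
  have hderiv : ∀ n s, HasDerivAt (fun s => ∑ X ∈ T n, cov[F, V X; νn n s])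
      (-(∑ X ∈ T n, ∑ A ∈ T n, (cov[fun U => F U * V X U, V A; νn n s] - (∫ U, F U ∂(νn n s)) * cov[V X, V A; νn n s] -
        (∫ U, V X U ∂(νn n s)) * cov[F, V A; νn n s]))) s := by
    intro n s
    have hX : ∀ X ∈ T n, HasDerivAt (fun s => cov[F, V X; νn n s])
        (-(∑ A ∈ T n, (cov[fun U => F U * V X U, V A; νn n s] - (∫ U, F U ∂(νn n s)) * cov[V X, V A; νn n s] -
          (∫ U, V X U ∂(νn n s)) * cov[F, V A; νn n s]))) s := by
      intro X _
      obtain ⟨CX, hCX⟩ := hVb X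
      have h := hasDerivAt_cov_of_mem_perturbedGibbsMeasuresS_add_smul (fundamentalRep (Fin N)) (continuous_fundamentalRep (Fin N)) (N * β) hBW
        hW'.continuous hW'.dependsOn (hVnc n) (hVndep n) (hVnsupp n) (fun _ => subset_rfl) huniq hμ (hνn n) hFm hMF (hV.continuous X).measurable
        hCX s
      refine h.congr_deriv ?_
      congr 1
      refine sum_congr rfl fun A hA => ?_
      simp only [hVn, Set.indicator_of_mem (Finset.mem_coe.2 hA)]
    have hs := HasDerivAt.fun_sum hX
    rw [← sum_neg_distrib]
    exact hs
  -- (b) the uniform bound on the derivative along the truncated lines (second-order susceptibility partial sums)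
  have hbound2 : ∀ n, ∀ s ∈ J, |∑ X ∈ T n, ∑ A ∈ T n, (cov[fun U => F U * V X U, V A; νn n s] - (∫ U, F U ∂(νn n s)) * cov[V X, V A; νn n s] -
        (∫ U, V X U ∂(νn n s)) * cov[F, V A; νn n s])| ≤ K₂ := by
    intro n s hs
    have hm : MemBallZdS a' Λ' t (W + s • Vn n) := memBallZdS_add_smul_indicator hW hV haV hΛV ha' hΛ' (habs hs) _
    refine (abs_sum_le_sum_abs _ _).trans ((sum_le_sum fun X _ => abs_sum_le_sum_abs _ _).trans ?_)
    rw [hK₂]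
    exact sum_abs_threePoint_le_S hd hN hc hv hb hP hVB ht hρ hm (hνn n s) hFm hFdep hMF hδF (fun X => (hV.continuous X).measurable)
      hV.dependsOn hVb hlipV hLs hL hL2s hL2 (fun X => (hV.continuous X).measurable) hV.dependsOn hVb hlipV hLs hL hL2s hL2 _ _
  -- (c) the mean value inequality along the truncated lines
  have hlipn : ∀ n, ∀ σ ∈ J, |(∑ X ∈ T n, cov[F, V X; νn n σ]) - ∑ X ∈ T n, cov[F, V X; νn n 0]| ≤ K₂ * |σ| := by
    intro n σ hσ
    have hsub : Set.uIcc 0 σ ⊆ J := fun x hx => by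
      rcases Set.mem_uIcc.1 hx with ⟨h0x, hxs⟩ | ⟨hsx, hx0⟩
      · exact ⟨by linarith [hσ.1], hxs.trans hσ.2⟩
      · exact ⟨hσ.1.trans hsx, by linarith [hσ.2]⟩
    have hg : ∀ x ∈ Set.uIcc (0 : ℝ) σ, HasDerivWithinAt (fun s => ∑ X ∈ T n, cov[F, V X; νn n s])
        (-(∑ X ∈ T n, ∑ A ∈ T n, (cov[fun U => F U * V X U, V A; νn n x] - (∫ U, F U ∂(νn n x)) * cov[V X, V A; νn n x] -
          (∫ U, V X U ∂(νn n x)) * cov[F, V A; νn n x]))) (Set.uIcc 0 σ) x := fun x _ => (hderiv n x).hasDerivWithinAt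
    have hbd : ∀ x ∈ Set.uIcc (0 : ℝ) σ, ‖-(∑ X ∈ T n, ∑ A ∈ T n, (cov[fun U => F U * V X U, V A; νn n x] -
        (∫ U, F U ∂(νn n x)) * cov[V X, V A; νn n x] - (∫ U, V X U ∂(νn n x)) * cov[F, V A; νn n x]))‖ ≤ K₂ := fun x hx => by
      rw [norm_neg, Real.norm_eq_abs]; exact hbound2 n x (hsub hx)
    have h := (convex_uIcc (0 : ℝ) σ).norm_image_sub_le_of_norm_hasDerivWithin_le hg hbd Set.left_mem_uIcc Set.right_mem_uIcc
    rw [Real.norm_eq_abs, Real.norm_eq_abs, sub_zero] at h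
    exact h
  -- (d) the truncated susceptibility sums converge to the series (screened stability + one summable majorant)
  have hunif : ∀ {g : LGConfig d (Matrix.specialUnitaryGroup (Fin N) ℂ) → ℝ} {Δ : Finset (ZdEdge d)} {M : ℝ} {δ : ZdEdge d → ℝ},
      Measurable g → DependsOn g (↑Δ : Set (ZdEdge d)) → (∀ σ, |g σ| ≤ M) → IsLipBound suFrobDist g δ →
      TendstoUniformlyOn (fun n s => ∫ σ, g σ ∂(νn n s)) (fun s => ∫ σ, g σ ∂(ν s)) atTop J :=
    fun hgm hgdep hM hδ => tendstoUniformlyOn_integral_truncation_S hd hN hc hv hb hP hVB ht hρ hW hV haV hΛV hs₀.le ha' hΛ' hT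
      (fun n s _ => hνn n s) hν hgm hgdep hM hδ
  set A₀ : ℝ := 2 * (2 * Real.sqrt N) ^ 2 * ∑ y ∈ ΛF, δF y with hA₀
  set LX : Finset (ZdEdge d) → ℝ := fun X => ∑ y ∈ X, lipV X y with hLX
  set g₀ : ZdEdge d → ℝ := fun e => exp (-t * linkSetDist ΛF e) with hg₀
  set Φ : Finset (ZdEdge d) → ℝ := fun X => A₀ * LX X * ∑ e ∈ X, g₀ e with hΦ
  have hδ0 : 0 ≤ ∑ y ∈ ΛF, δF y := sum_nonneg fun y _ => hδF.nonneg y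
  have hA₀0 : 0 ≤ A₀ := by positivity
  have hLX0 : ∀ X, 0 ≤ LX X := fun X => sum_nonneg fun y _ => (hlipV X).nonneg y
  have hg₀0 : ∀ e, 0 ≤ g₀ e := fun e => (exp_pos _).le
  have hΦ0 : ∀ X, 0 ≤ Φ X := fun X => mul_nonneg (mul_nonneg hA₀0 (hLX0 X)) (sum_nonneg fun e _ => hg₀0 e)
  have hd0 : 0 < d := hd
  have hL0 : 0 ≤ L := le_trans (tsum_nonneg fun X => by split_ifs; exacts [hLX0 X, le_rfl]) (hL (0, ⟨0, hd0⟩))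
  have hΦs : Summable Φ := by
    refine summable_of_sum_le hΦ0 (c := A₀ * L * (ΛF.card * (d * ((1 + exp (-(t / d))) / (1 - exp (-(t / d)))) ^ d)))
      fun Tf => ?_
    have h1 : ∑ X ∈ Tf, Φ X = A₀ * ∑ X ∈ Tf, LX X * ∑ e ∈ X, g₀ e := by rw [mul_sum]; exact sum_congr rfl fun X _ => by ring
    rw [h1]
    by_cases hΛF : ΛF.Nonempty
    · obtain ⟨hgs, hgt⟩ := summable_exp_neg_linkSetDist hd ht hΛF
      calc A₀ * ∑ X ∈ Tf, LX X * ∑ e ∈ X, g₀ e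
          ≤ A₀ * (L * (ΛF.card * (d * ((1 + exp (-(t / d))) / (1 - exp (-(t / d)))) ^ d))) :=
            mul_le_mul_of_nonneg_left ((sum_mul_sum_le_of_load hg₀0 hgs hLX0 hL0 hLs hL).trans
              (mul_le_mul_of_nonneg_left hgt hL0)) hA₀0
        _ = _ := by ring
    · simp [hA₀, Finset.not_nonempty_iff_eq_empty.1 hΛF]
  have hboundΦ : ∀ {W' : Potential (ZdEdge d) (Matrix.specialUnitaryGroup (Fin N) ℂ)}, MemBallZdS a' Λ' t W' →
      ∀ {μ' : Measure (LGConfig d (Matrix.specialUnitaryGroup (Fin N) ℂ))},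
        μ' ∈ perturbedGibbsMeasuresS (d := d) (fundamentalRep (Fin N)) (N * β) W' → ∀ X, |cov[F, V X; μ']| ≤ Φ X := by
    intro W'' hW'' μ' hμ' X
    obtain ⟨B', hB'⟩ := hW''.summable
    obtain ⟨osc', lip', ℓ', hosc', hlip', hoscs', hosca', hlips', hℓ', hℓs', hℓt'⟩ := hW''.loads
    obtain ⟨CX, hCX⟩ := hVb X
    have h1 := abs_cov_le_of_isLipBound_S hd hN hc hv hb hP hVB hB' hW''.continuous hW''.dependsOn hosc' hoscs' hosca' hlip' hlips'
      hℓ' ht.le hℓs' hℓt' hρ hμ' hFm hFdep hMF hδF (hV.continuous X).measurable (hV.dependsOn X) hCX (hlipV X)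
    refine le_mul_sum_exp_of_le_mul_exp ht.le hA₀0 (hLX0 X) ?_ (fun hX => ?_) (fun hΔ => ?_)
    · simpa only [hA₀, hLX, mul_assoc, mul_comm, mul_left_comm] using h1
    · simp only [hLX, Finset.not_nonempty_iff_eq_empty.1 hX, sum_empty]
    · simp only [hA₀, Finset.not_nonempty_iff_eq_empty.1 hΔ, sum_empty, mul_zero]
  have hc' : ∀ n, ∀ s ∈ J, ∀ X, |cov[F, V X; νn n s]| ≤ Φ X := fun n s hs X =>
    hboundΦ (memBallZdS_add_smul_indicator hW hV haV hΛV ha' hΛ' (habs hs) _) (hνn n s) X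
  have hcinf : ∀ s ∈ J, ∀ X, |cov[F, V X; ν s]| ≤ Φ X := fun s hs X => by
    have hm := memBallZdS_add_smul_indicator hW hV haV hΛV ha' hΛ' (habs hs) Set.univ
    rw [Set.indicator_univ] at hm
    exact hboundΦ hm (hν s hs) X
  have hMF0 : 0 ≤ MF := (abs_nonneg _).trans (hMF fun _ => 1)
  have hconv : ∀ X, TendstoUniformlyOn (fun n s => cov[F, V X; νn n s]) (fun s => cov[F, V X; ν s]) atTop J := by
    intro X
    obtain ⟨CX, hCX⟩ := hVb X
    have hCX0 : 0 ≤ CX := (abs_nonneg _).trans (hCX fun _ => 1)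
    exact tendstoUniformlyOn_cov (fun n s _ => hprob_n n s) (fun s hs => hprob s hs) hFm (hV.continuous X).measurable hMF0 hCX0
      hMF hCX (hunif hFm hFdep hMF hδF) (hunif (hV.continuous X).measurable (hV.dependsOn X) hCX (hlipV X))
      (hunif (hFm.mul (hV.continuous X).measurable) (dependsOn_mul_union hFdep (hV.dependsOn X))
        (fun σ => by rw [abs_mul]; exact mul_le_mul (hMF σ) (hCX σ) (abs_nonneg _) hMF0)
        (isLipBound_mul_of_abs_le (fun _ _ => suFrobDist_nonneg _ _) hMF0 hCX0 hMF hCX hδF (hlipV X)))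
  have hU := tendstoUniformlyOn_finsetSum_tsum hT hΦ0 hΦs hc' hcinf hconv
  -- (e) pass to the limit in the Lipschitz bound
  intro σ hσ
  have h0J : (0 : ℝ) ∈ J := ⟨by linarith, hs₀.le⟩
  have hlimσ : Tendsto (fun n => ∑ X ∈ T n, cov[F, V X; νn n σ]) atTop (𝓝 (∑' X, cov[F, V X; ν σ])) := hU.tendsto_at hσ
  have hlim0 : Tendsto (fun n => ∑ X ∈ T n, cov[F, V X; νn n 0]) atTop (𝓝 (∑' X, cov[F, V X; ν 0])) := hU.tendsto_at h0J
  have hlim := (hlimσ.sub hlim0).abs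
  exact le_of_tendsto' hlim fun n => hlipn n σ hσ

/-- ★★ **THE UNIFORM SECOND-ORDER TAYLOR BOUND ON THE WEIGHTED BALL.**  Under the hypotheses of `abs_tsum_cov_sub_tsum_cov_le_lipschitz_S`, for
every `|s| < s₀`: `|∫F dν(s) − ∫F dν(0) + s·Σ'_X cov_{ν(0)}(F, V_X)| ≤ K₂ · s²`. -/
theorem abs_taylor_remainder_two_le_S (hd : 1 ≤ d) (hN : 1 ≤ N) {β b c v a' Λ' t : ℝ}
    (hc : 0 ≤ c) (hv : 0 ≤ v) (hb : |β| * (2 * ((d : ℝ) - 1)) ≤ b)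
    (hP : ∀ B : Matrix (Fin N) (Fin N) ℂ, matrixOpNorm B ≤ b →
      ∀ (ψ : Matrix.specialUnitaryGroup (Fin N) ℂ → ℝ) (M : ℝ), 0 ≤ M →
        (∀ x y, |ψ x - ψ y| ≤ M * suFrobDist x y) →
        Var[ψ; (haarProbability (Matrix.specialUnitaryGroup (Fin N) ℂ)).tilted
          fun g => (N : ℝ) * ((g : Matrix (Fin N) (Fin N) ℂ) * B).trace.re] ≤ c * M ^ 2)
    (hVB : ∀ B : Matrix (Fin N) (Fin N) ℂ, matrixOpNorm B ≤ b → ∀ Δ : Matrix (Fin N) (Fin N) ℂ,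
      Var[fun g : Matrix.specialUnitaryGroup (Fin N) ℂ =>
          (N : ℝ) * ((g : Matrix (Fin N) (Fin N) ℂ) * Δ).trace.re;
        (haarProbability (Matrix.specialUnitaryGroup (Fin N) ℂ)).tilted
          fun g => (N : ℝ) * ((g : Matrix (Fin N) (Fin N) ℂ) * B).trace.re] ≤ v * frobNorm Δ ^ 2)
    (ht : 0 < t) (hρ : 6 * ((d : ℝ) - 1) * |β| * (exp a' * exp t * Real.sqrt (c * v)) + exp (a' / 2) * Real.sqrt c * Λ' < 1)
    {a Λ aV ΛV s₀ : ℝ} (hW : MemBallZdS a Λ t W) (hV : MemBallZdS aV ΛV t V) (haV : 0 ≤ aV) (hΛV : 0 ≤ ΛV)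
    (hs₀ : 0 < s₀) (ha' : a + s₀ * aV ≤ a') (hΛ' : Λ + s₀ * ΛV ≤ Λ')
    {lipV : Finset (ZdEdge d) → ZdEdge d → ℝ} (hlipV : ∀ X, IsLipBound suFrobDist (V X) (lipV X)) {L L₂ : ℝ}
    (hLs : ∀ e, Summable fun X : Finset (ZdEdge d) => (if e ∈ X then ∑ y ∈ X, lipV X y else 0))
    (hL : ∀ e, ∑' X : Finset (ZdEdge d), (if e ∈ X then ∑ y ∈ X, lipV X y else 0) ≤ L)
    (hL2s : ∀ e, Summable fun X : Finset (ZdEdge d) => (if e ∈ X then X.card * ∑ y ∈ X, lipV X y else 0))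
    (hL2 : ∀ e, ∑' X : Finset (ZdEdge d), (if e ∈ X then X.card * ∑ y ∈ X, lipV X y else 0) ≤ L₂)
    {ν : ℝ → Measure (LGConfig d (Matrix.specialUnitaryGroup (Fin N) ℂ))}
    (hν : ∀ s ∈ Set.Icc (-s₀) s₀, ν s ∈ perturbedGibbsMeasuresS (d := d) (fundamentalRep (Fin N)) (N * β) (W + s • V))
    {F : LGConfig d (Matrix.specialUnitaryGroup (Fin N) ℂ) → ℝ} (hFm : Measurable F) {ΛF : Finset (ZdEdge d)}
    (hFdep : DependsOn F (↑ΛF : Set (ZdEdge d))) {MF : ℝ} (hMF : ∀ σ, |F σ| ≤ MF) {δF : ZdEdge d → ℝ}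
    (hδF : IsLipBound suFrobDist F δF) :
    ∀ s ∈ Set.Ioo (-s₀) s₀,
      |(∫ U, F U ∂(ν s)) - (∫ U, F U ∂(ν 0)) + s * ∑' X : Finset (ZdEdge d), cov[F, V X; ν 0]| ≤
        768 * N * Real.sqrt N * (∑ y ∈ ΛF, δF y) *
          (ΛF.card * (d * ((1 + exp (-(t / 3 / d))) / (1 - exp (-(t / 3 / d)))) ^ d)) *
          (L * L * (ΛF.card * (d * ((1 + exp (-(t / 3 / d))) / (1 - exp (-(t / 3 / d)))) ^ d)) +
            L * L₂ * (d * ((1 + exp (-(t / 3 / d))) / (1 - exp (-(t / 3 / d)))) ^ d) +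
            L * L₂ * (d * ((1 + exp (-(t / 3 / d))) / (1 - exp (-(t / 3 / d)))) ^ d)) * s ^ 2 := by
  intro s hs
  obtain ⟨K₂, hK₂⟩ : ∃ K : ℝ, K = 768 * N * Real.sqrt N * (∑ y ∈ ΛF, δF y) *
      (ΛF.card * (d * ((1 + exp (-(t / 3 / d))) / (1 - exp (-(t / 3 / d)))) ^ d)) *
      (L * L * (ΛF.card * (d * ((1 + exp (-(t / 3 / d))) / (1 - exp (-(t / 3 / d)))) ^ d)) +
        L * L₂ * (d * ((1 + exp (-(t / 3 / d))) / (1 - exp (-(t / 3 / d)))) ^ d) +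
        L * L₂ * (d * ((1 + exp (-(t / 3 / d))) / (1 - exp (-(t / 3 / d)))) ^ d)) := ⟨_, rfl⟩
  rw [← hK₂]
  -- (a) the derivative along the line and (b) the Lipschitz modulus of the susceptibility series
  obtain ⟨hder, -⟩ := hasDerivAt_and_continuousOn_direction_S hd hN hc hv hb hP hVB ht hρ hW hV haV hΛV hs₀ ha' hΛ' hlipV hLs hL hν hFm hFdep
    hMF hδF
  have hmod := abs_tsum_cov_sub_tsum_cov_le_lipschitz_S hd hN hc hv hb hP hVB ht hρ hW hV haV hΛV hs₀ ha' hΛ' hlipV hLs hL hL2s hL2 hν hFm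
    hFdep hMF hδF
  rw [← hK₂] at hmod
  have hK0 : 0 ≤ K₂ := by
    have h := hmod 0 ⟨by linarith, hs₀.le⟩
    have h1 := hmod s₀ ⟨by linarith, le_rfl⟩
    rw [abs_of_pos hs₀] at h1
    nlinarith [abs_nonneg ((∑' X : Finset (ZdEdge d), cov[F, V X; ν s₀]) - ∑' X : Finset (ZdEdge d), cov[F, V X; ν 0])]
  -- (c) the mean value inequality for `g(σ) := ∫F dν(σ) − ∫F dν(0) + σ·χ(0)` on the segment `[0, s]`
  obtain ⟨χ₀, hχ₀⟩ : ∃ x : ℝ, x = ∑' X : Finset (ZdEdge d), cov[F, V X; ν 0] := ⟨_, rfl⟩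
  rw [← hχ₀]
  have hsub : Set.uIcc 0 s ⊆ Set.Ioo (-s₀) s₀ := fun σ hσ => by
    rcases Set.mem_uIcc.1 hσ with ⟨h0σ, hσs⟩ | ⟨hsσ, hσ0⟩
    · exact ⟨by linarith [hs.1], lt_of_le_of_lt hσs hs.2⟩
    · exact ⟨lt_of_lt_of_le hs.1 hsσ, by linarith [hs.2]⟩
  have habsσ : ∀ σ ∈ Set.uIcc (0 : ℝ) s, |σ| ≤ |s| := fun σ hσ => by
    rcases Set.mem_uIcc.1 hσ with ⟨h0σ, hσs⟩ | ⟨hsσ, hσ0⟩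
    · rw [abs_of_nonneg h0σ, abs_of_nonneg (h0σ.trans hσs)]; exact hσs
    · rw [abs_of_nonpos hσ0, abs_of_nonpos (hsσ.trans hσ0)]; linarith
  have hg : ∀ σ ∈ Set.uIcc (0 : ℝ) s, HasDerivWithinAt
      (fun σ => (∫ U, F U ∂(ν σ)) - (∫ U, F U ∂(ν 0)) + σ * χ₀)
      (-(∑' X : Finset (ZdEdge d), cov[F, V X; ν σ]) + χ₀) (Set.uIcc 0 s) σ := fun σ hσ => by
    have h1 := (hder σ (hsub hσ)).sub_const (∫ U, F U ∂(ν 0))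
    have h2 : HasDerivAt (fun σ : ℝ => σ * χ₀) χ₀ σ := by simpa using (hasDerivAt_id σ).mul_const χ₀
    exact (h1.add h2).hasDerivWithinAt
  have hbound : ∀ σ ∈ Set.uIcc (0 : ℝ) s, ‖-(∑' X : Finset (ZdEdge d), cov[F, V X; ν σ]) + χ₀‖ ≤ K₂ * |s| := by
    intro σ hσ
    rw [Real.norm_eq_abs, hχ₀, neg_add_eq_sub, abs_sub_comm]
    exact (hmod σ (Set.Ioo_subset_Icc_self (hsub hσ))).trans (mul_le_mul_of_nonneg_left (habsσ σ hσ) hK0)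
  have hmvt := (convex_uIcc (0 : ℝ) s).norm_image_sub_le_of_norm_hasDerivWithin_le hg hbound Set.left_mem_uIcc Set.right_mem_uIcc
  simp only [sub_self, zero_mul, add_zero, sub_zero, Real.norm_eq_abs] at hmvt
  calc |(∫ U, F U ∂(ν s)) - (∫ U, F U ∂(ν 0)) + s * χ₀| ≤ K₂ * |s| * |s| := hmvt
    _ = K₂ * s ^ 2 := by rw [mul_assoc, ← sq_abs, sq]

end SUN

end Summit.Ventures.YMGap.RobustBall

end
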